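import Mathlib.Analysis.Calculus.FDeriv.Mul
import Mathlib.Analysis.Calculus.FDeriv.Add
import Mathlib.Analysis.Calculus.FDeriv.Prod
import Mathlib.LinearAlgebra.Basis.VectorSpace
import Mathlib.LinearAlgebra.Dimension.OrzechProperty
import Mathlib.Algebra.BigOperators.Pi
import Literature.NumberTheory.Transcendental.AnalytificationCharts
import Literature.NumberTheory.Transcendental.AnalytificationProofs
import Literature.AlgebraicGeometry.Motives.AlgPointsProperProofs
import Literature.Geometry.Kaehler.AnalyticSetRegular
import HarnessLib

/-!
# GAGA dimension comparison — differentials of regular functions in an algebraic chart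

Third proof file for the named fact
`Literature.AlgebraicGeometry.HodgeTheory.gaga_le_coheight_of_regularLocus_codim`
(`HodgeTheory/GAGADimension.lean`; Serre, *GAGA* §6 Prop. 3 Cor. 2–3, p. 11). It is the analytic
half of Serre's «point simple» argument (GAGA §1 n°4: at a point where the Jacobian criterion holds
the analytic space is locally `ℂᵈ`; §2 n°6 Cor. 2: the algebraic and analytic local rings have the
same dimension, a regular system of parameters of `𝒪_x` giving local analytic coordinates), carried
out on the model `X(ℂ)` of `X^h` whose charts are the *algebraic charts* of
`Literature.NumberTheory.Transcendental.exists_algebraicChart` (coordinates are regular functions,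
regular functions read holomorphically). For a chart `e` at a complex point `Q₀` and an affine open
`U ∋ Q₀`, write `d s := fderiv ℂ (s ∘ e⁻¹) (e Q₀)` for `s ∈ Γ(X, U)` (spelled out with
`AlgPoints.evalOrZero`) and `𝔪 = {s | s(Q₀) = 0} = ker (evaluation at Q₀)`.

* `fderiv_chart_mul`, `fderiv_chart_add`, `fderiv_chart_smul`, `fderiv_chart_sum`,
  `fderiv_chart_scalarRingHom` — `d` is a `ℂ`-linear derivation at `Q₀` (Leibniz rule through
  Mathlib `fderiv_fun_smul`; constants read as constant functions);
  `fderiv_chart_eq_zero_of_mem_sq` — `d` kills `𝔪²`.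
* `fderiv_chart_coord` — the chart coordinates `xᵢ` have `dxᵢ = prᵢ`.
* `fderiv_chart_mem_span`, `linearIndependent_fderiv_chart` — if `t₁, …, tₙ` span `𝔪` modulo
  `𝔪²` over `ℂ` (the algebraic input `GAGADimension.exists_simplePointData`), then every `d a` is a
  combination of the `dtᵢ`, each `prᵢ` is one (reading `xᵢ = a / uᵐ` on a basic open
  `D(u) ⊆ U ∩ U₁`, `AlgPoints.exists_map_mul_pow_eq_algebraMap`), so the `dtᵢ` span the dual of `ℂⁿ`
  and are linearly independent;
* `mem_sq_of_fderiv_chart_eq_zero` — hence `ker d ∩ 𝔪 = 𝔪²` (**the embedding dimension of `X(ℂ)`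
  at `Q₀` is that of `𝒪_{X,Q₀}`**).

The consequences for `c` functions `gⱼ ∈ 𝔪` independent modulo `𝔪²` (`(dgⱼ)` onto; `Q₀` is a
regular point of codimension `c` of their zero set) are in `GAGADimensionRegularPoint.lean`.

## References

* J.-P. Serre, *Géométrie algébrique et géométrie analytique*, Ann. Inst. Fourier **6** (1956),
  §1 n°4, §2 n°5 Prop. 2, n°6 Prop. 3 Cor. 2–3 (p. 11). [SerreGAGA1956]
* P. Griffiths, J. Harris, *Principles of Algebraic Geometry* (1978), Ch. 0 §2 (regular points of
  analytic sets), Ch. 1 §1 (Zariski tangent space and differentials).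
-/


noncomputable section

open scoped Manifold ContDiff Topology
open CategoryTheory AlgebraicGeometry Filter
open Literature.AlgebraicGeometry.Motives
open Literature.AlgebraicGeometry.Motives.AlgPoints (evalOrZero evalOrZero_of_mem evalOrZero_of_not_mem)

namespace Literature.AlgebraicGeometry.HodgeTheory

namespace GAGADimension

variable {X : SchemeOver ℂ} {n : ℕ}

/-! ### Pointwise identities for `evalOrZero` -/

section Pointwise

/-- `evalOrZero U` is multiplicative (on `U(ℂ)` it is the evaluation ring homomorphism, off `U(ℂ)`
both sides vanish). [folklore] -/
theorem evalOrZero_mul (U : X.left.Opens) (s t : Γ(X.left, U)) :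
    (evalOrZero U (s * t) : ComplexPoints X → ℂ) = evalOrZero U s * evalOrZero U t := by
  funext Q
  by_cases hQ : Q.pt ∈ U
  · simp only [Pi.mul_apply, evalOrZero_of_mem _ hQ, ← AlgPoints.evalRingHom_apply, map_mul]
  · simp only [Pi.mul_apply, evalOrZero_of_not_mem _ hQ, mul_zero]

/-- `evalOrZero U` is additive. [folklore] -/
theorem evalOrZero_add (U : X.left.Opens) (s t : Γ(X.left, U)) :
    (evalOrZero U (s + t) : ComplexPoints X → ℂ) = evalOrZero U s + evalOrZero U t := by
  funext Q
  by_cases hQ : Q.pt ∈ U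
  · simp only [Pi.add_apply, evalOrZero_of_mem _ hQ, ← AlgPoints.evalRingHom_apply, map_add]
  · simp only [Pi.add_apply, evalOrZero_of_not_mem _ hQ, add_zero]

/-- The scalar `c` takes the value `c` at every complex point of `U`. [folklore] -/
theorem evalOrZero_scalarRingHom (U : X.left.Opens) (c : ℂ) {Q : ComplexPoints X}
    (hQ : Q.pt ∈ U) : evalOrZero U (SchemeOver.scalarRingHom X U c) Q = c := by
  rw [evalOrZero_of_mem _ hQ, AlgPoints.eval_scalarRingHom]
  rfl

end Pointwise

/-! ### The differential at a point of a regular function read in an algebraic chart -/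

section Chart

variable (e : OpenPartialHomeomorph (ComplexPoints X) (Fin n → ℂ)) {Q₀ : ComplexPoints X}
  (hQ₀ : Q₀ ∈ e.source)
  (hol : ∀ (U : X.left.affineOpens) (s : Γ(X.left, ↑U)),
    ContDiffOn ℂ ω (evalOrZero ↑U s ∘ e.symm)
      (e.target ∩ e.symm ⁻¹' {Q | Q.pt ∈ (↑U : X.left.Opens)}))

include hQ₀ in
/-- The chart image of `U(ℂ)`, `e.target ∩ e⁻¹⁻¹(U(ℂ))`, is a neighbourhood of `e Q₀` when
`Q₀ ∈ U(ℂ)`. [folklore] -/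
theorem chart_nhds {U : X.left.Opens} (hU : Q₀.pt ∈ U) :
    e.target ∩ e.symm ⁻¹' {Q : ComplexPoints X | Q.pt ∈ U} ∈ 𝓝 (e Q₀) :=
  (e.isOpen_inter_preimage_symm (AlgPoints.isOpen_setOf_pt_mem U)).mem_nhds
    ⟨e.map_source hQ₀, by
      simp only [Set.mem_preimage, Set.mem_setOf_eq, e.left_inv hQ₀]
      exact hU⟩

include hQ₀ hol in
/-- Regular functions are differentiable at `e Q₀` when read in the chart. [folklore] -/
theorem differentiableAt_chart (U : X.left.affineOpens) (hU : Q₀.pt ∈ (↑U : X.left.Opens))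
    (s : Γ(X.left, ↑U)) : DifferentiableAt ℂ (evalOrZero ↑U s ∘ e.symm) (e Q₀) :=
  ((hol U s).differentiableOn (by simp)).differentiableAt (chart_nhds e hQ₀ hU)

include hQ₀ in
/-- Near `e Q₀`, the read-off function `s ∘ e⁻¹` takes at `w` the value of `s` at the point
`e⁻¹ w ∈ U(ℂ)`. [folklore] -/
theorem eventually_chart_mem {U : X.left.Opens} (hU : Q₀.pt ∈ U) :
    ∀ᶠ w in 𝓝 (e Q₀), w ∈ e.target ∧ (e.symm w).pt ∈ U :=
  Filter.mem_of_superset (chart_nhds e hQ₀ hU) fun _ hw => ⟨hw.1, hw.2⟩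

include hQ₀ in
/-- **Constants have zero differential**: the scalar `c ∈ Γ(X, U)` reads as the constant function
`c` near `e Q₀`. [folklore] -/
theorem fderiv_chart_scalarRingHom (U : X.left.affineOpens) (hU : Q₀.pt ∈ (↑U : X.left.Opens))
    (c : ℂ) :
    fderiv ℂ (evalOrZero ↑U (SchemeOver.scalarRingHom X ↑U c) ∘ e.symm) (e Q₀) = 0 := by
  have h : evalOrZero ↑U (SchemeOver.scalarRingHom X ↑U c) ∘ e.symm =ᶠ[𝓝 (e Q₀)]
      fun _ => c := by
    filter_upwards [eventually_chart_mem e hQ₀ hU] with w hw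
    exact evalOrZero_scalarRingHom _ c hw.2
  rw [h.fderiv_eq, fderiv_const_apply]

include hQ₀ hol in
/-- **Leibniz rule** for the differential at `e Q₀` of regular functions read in the chart.
[folklore] -/
theorem fderiv_chart_mul (U : X.left.affineOpens) (hU : Q₀.pt ∈ (↑U : X.left.Opens))
    (s t : Γ(X.left, ↑U)) :
    fderiv ℂ (evalOrZero ↑U (s * t) ∘ e.symm) (e Q₀) =
      Q₀.eval ↑U hU s • fderiv ℂ (evalOrZero ↑U t ∘ e.symm) (e Q₀) +
        Q₀.eval ↑U hU t • fderiv ℂ (evalOrZero ↑U s ∘ e.symm) (e Q₀) := by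
  have h : evalOrZero ↑U (s * t) ∘ e.symm =
      fun w => (evalOrZero ↑U s ∘ e.symm) w • (evalOrZero ↑U t ∘ e.symm) w := by
    rw [evalOrZero_mul]
    rfl
  rw [h, fderiv_fun_smul (differentiableAt_chart e hQ₀ hol U hU s)
    (differentiableAt_chart e hQ₀ hol U hU t)]
  have e1 : (evalOrZero ↑U s ∘ e.symm) (e Q₀) = Q₀.eval ↑U hU s := by
    simp [e.left_inv hQ₀, evalOrZero_of_mem _ hU]
  have e2 : (evalOrZero ↑U t ∘ e.symm) (e Q₀) = Q₀.eval ↑U hU t := by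
    simp [e.left_inv hQ₀, evalOrZero_of_mem _ hU]
  rw [e1, e2]
  congr 1
  ext v
  simp [mul_comm]

include hQ₀ hol in
/-- Additivity of the differential at `e Q₀`. [folklore] -/
theorem fderiv_chart_add (U : X.left.affineOpens) (hU : Q₀.pt ∈ (↑U : X.left.Opens))
    (s t : Γ(X.left, ↑U)) :
    fderiv ℂ (evalOrZero ↑U (s + t) ∘ e.symm) (e Q₀) =
      fderiv ℂ (evalOrZero ↑U s ∘ e.symm) (e Q₀) + fderiv ℂ (evalOrZero ↑U t ∘ e.symm) (e Q₀) := by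
  have h : evalOrZero ↑U (s + t) ∘ e.symm =
      (evalOrZero ↑U s ∘ e.symm) + (evalOrZero ↑U t ∘ e.symm) := by
    rw [evalOrZero_add]
    rfl
  rw [h, fderiv_add (differentiableAt_chart e hQ₀ hol U hU s)
    (differentiableAt_chart e hQ₀ hol U hU t)]

include hQ₀ hol in
/-- Homogeneity: `d(c s) = c ds` for a scalar `c`. [folklore] -/
theorem fderiv_chart_smul (U : X.left.affineOpens) (hU : Q₀.pt ∈ (↑U : X.left.Opens))
    (c : ℂ) (s : Γ(X.left, ↑U)) :
    fderiv ℂ (evalOrZero ↑U (SchemeOver.scalarRingHom X ↑U c * s) ∘ e.symm) (e Q₀) =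
      c • fderiv ℂ (evalOrZero ↑U s ∘ e.symm) (e Q₀) := by
  have h : evalOrZero ↑U (SchemeOver.scalarRingHom X ↑U c * s) ∘ e.symm =ᶠ[𝓝 (e Q₀)]
      fun w => c • (evalOrZero ↑U s ∘ e.symm) w := by
    filter_upwards [eventually_chart_mem e hQ₀ hU] with w hw
    simp only [Function.comp_apply, smul_eq_mul, evalOrZero_of_mem _ hw.2,
      ← AlgPoints.evalRingHom_apply, map_mul]
    rw [AlgPoints.evalRingHom_apply, AlgPoints.evalRingHom_apply, AlgPoints.eval_scalarRingHom]
    rfl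
  rw [h.fderiv_eq, fderiv_fun_const_smul (differentiableAt_chart e hQ₀ hol U hU s) c]

include hQ₀ hol in
/-- Finite sums. [folklore] -/
theorem fderiv_chart_sum (U : X.left.affineOpens) (hU : Q₀.pt ∈ (↑U : X.left.Opens))
    {ι : Type*} (I : Finset ι) (s : ι → Γ(X.left, ↑U)) :
    fderiv ℂ (evalOrZero ↑U (∑ i ∈ I, s i) ∘ e.symm) (e Q₀) =
      ∑ i ∈ I, fderiv ℂ (evalOrZero ↑U (s i) ∘ e.symm) (e Q₀) := by
  classical
  induction I using Finset.induction_on with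
  | empty =>
    rw [Finset.sum_empty, Finset.sum_empty, ← map_zero (SchemeOver.scalarRingHom X ↑U),
      fderiv_chart_scalarRingHom e hQ₀ U hU]
  | insert a I ha ih =>
    rw [Finset.sum_insert ha, Finset.sum_insert ha, fderiv_chart_add e hQ₀ hol U hU, ih]

include hQ₀ hol in
/-- **The differential kills `𝔪²`**: products of two regular functions vanishing at `Q₀` have zero
differential at `e Q₀`, hence so does every element of the square of the maximal ideal
`𝔪 = {s | s(Q₀) = 0}`. [folklore] -/
theorem fderiv_chart_eq_zero_of_mem_sq (U : X.left.affineOpens) (hU : Q₀.pt ∈ (↑U : X.left.Opens))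
    {a : Γ(X.left, ↑U)} (ha : a ∈ RingHom.ker (Q₀.evalRingHom ↑U hU) ^ 2) :
    fderiv ℂ (evalOrZero ↑U a ∘ e.symm) (e Q₀) = 0 := by
  rw [pow_two] at ha
  refine Submodule.mul_induction_on ha (fun s hs t ht => ?_) (fun x y hx hy => ?_)
  · rw [RingHom.mem_ker, AlgPoints.evalRingHom_apply] at hs ht
    rw [fderiv_chart_mul e hQ₀ hol U hU, hs, ht]
    ext v
    simp
  · rw [fderiv_chart_add e hQ₀ hol U hU, hx, hy, add_zero]

/-! ### Local coordinates: the differentials of `Γ(X, U)` span the cotangent space -/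

/-- A linear form on `ℂᶜ` is determined by its values on the standard basis:
`μ w = ∑ⱼ w j · μ(eⱼ)`. [folklore] -/
theorem dual_apply_eq_sum {c : ℕ} (μ : (Fin c → ℂ) →ₗ[ℂ] ℂ) (w : Fin c → ℂ) :
    μ w = ∑ j, w j * μ (Pi.single j 1) := by
  conv_lhs => rw [pi_eq_sum_univ' w]
  simp only [map_sum, map_smul, smul_eq_mul]

include hQ₀ hol in
/-- If `t₁, …, tₙ ∈ 𝔪` span `𝔪` modulo `𝔪²` over `ℂ` (`𝔪 = {a | a(Q₀) = 0} ⊂ Γ(X, U)`), then the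
differential at `e Q₀` of every `a ∈ Γ(X, U)` is a `ℂ`-combination of the `dtᵢ`. [folklore] -/
theorem fderiv_chart_mem_span (U : X.left.affineOpens) (hU : Q₀.pt ∈ (↑U : X.left.Opens))
    (t : Fin n → Γ(X.left, ↑U))
    (htspan : ∀ a ∈ RingHom.ker (Q₀.evalRingHom ↑U hU), ∃ coef : Fin n → ℂ,
      a - ∑ i, SchemeOver.scalarRingHom X ↑U (coef i) * t i ∈
        RingHom.ker (Q₀.evalRingHom ↑U hU) ^ 2)
    (a : Γ(X.left, ↑U)) :
    fderiv ℂ (evalOrZero ↑U a ∘ e.symm) (e Q₀) ∈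
      Submodule.span ℂ (Set.range fun i => fderiv ℂ (evalOrZero ↑U (t i) ∘ e.symm) (e Q₀)) := by
  set κ := SchemeOver.scalarRingHom X (↑U : X.left.Opens) with hκ
  have ha' : a - κ (Q₀.eval ↑U hU a) ∈ RingHom.ker (Q₀.evalRingHom ↑U hU) := by
    rw [RingHom.mem_ker, map_sub, AlgPoints.evalRingHom_apply, AlgPoints.evalRingHom_apply,
      AlgPoints.eval_scalarRingHom, sub_eq_zero]
    rfl
  obtain ⟨coef, hcoef⟩ := htspan _ ha'
  have h0 := fderiv_chart_eq_zero_of_mem_sq e hQ₀ hol U hU hcoef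
  have e1 : a = (a - κ (Q₀.eval ↑U hU a) - ∑ i, κ (coef i) * t i) +
      (∑ i, κ (coef i) * t i + κ (Q₀.eval ↑U hU a)) := by ring
  rw [e1, fderiv_chart_add e hQ₀ hol U hU, h0, zero_add, fderiv_chart_add e hQ₀ hol U hU,
    fderiv_chart_scalarRingHom e hQ₀ U hU, add_zero, fderiv_chart_sum e hQ₀ hol U hU]
  refine Submodule.sum_mem _ fun i _ => ?_
  rw [fderiv_chart_smul e hQ₀ hol U hU]
  exact Submodule.smul_mem _ _ (Submodule.subset_span ⟨i, rfl⟩)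

include hQ₀ in
/-- The coordinates of an algebraic chart are regular functions `xᵢ` whose read-off in the chart
is the `i`-th coordinate function, so `dxᵢ = prᵢ` at `e Q₀`. [folklore] -/
theorem fderiv_chart_coord (U₁ : X.left.affineOpens) (x : Fin n → Γ(X.left, ↑U₁))
    (hx : ∀ Q ∈ e.source, ∀ i, e Q i = evalOrZero ↑U₁ (x i) Q) (i : Fin n) :
    fderiv ℂ (evalOrZero ↑U₁ (x i) ∘ e.symm) (e Q₀) = ContinuousLinearMap.proj i := by
  have h : evalOrZero ↑U₁ (x i) ∘ e.symm =ᶠ[𝓝 (e Q₀)] fun w => w i := by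
    filter_upwards [e.open_target.mem_nhds (e.map_source hQ₀)] with w hw
    simp only [Function.comp_apply]
    rw [← hx _ (e.map_target hw) i, e.right_inv hw]
  rw [h.fderiv_eq]
  exact (hasFDerivAt_apply i (e Q₀)).fderiv

include hQ₀ hol in
/-- **The differentials of `Γ(X, U)` span the cotangent space.** If `t₁, …, tₙ` span
`𝔪 ⊂ Γ(X, U)` modulo `𝔪²` and `e` has regular coordinates, then `dt₁, …, dtₙ` span the dual of
`ℂⁿ` (each `prᵢ = dxᵢ` is the differential of a fraction `a / uᵐ`, `a, u ∈ Γ(X, U)`, read on a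
basic open `D(u) ⊆ U ∩ U₁`), hence are linearly independent. [folklore] -/
theorem linearIndependent_fderiv_chart (U : X.left.affineOpens) (hU : Q₀.pt ∈ (↑U : X.left.Opens))
    (t : Fin n → Γ(X.left, ↑U))
    (htspan : ∀ a ∈ RingHom.ker (Q₀.evalRingHom ↑U hU), ∃ coef : Fin n → ℂ,
      a - ∑ i, SchemeOver.scalarRingHom X ↑U (coef i) * t i ∈
        RingHom.ker (Q₀.evalRingHom ↑U hU) ^ 2)
    (alg : ∃ (U₁ : X.left.affineOpens) (x : Fin n → Γ(X.left, ↑U₁)),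
      e.source ⊆ {Q | Q.pt ∈ (↑U₁ : X.left.Opens)} ∧
        ∀ Q ∈ e.source, ∀ i, e Q i = evalOrZero ↑U₁ (x i) Q) :
    LinearIndependent ℂ fun i => fderiv ℂ (evalOrZero ↑U (t i) ∘ e.symm) (e Q₀) := by
  classical
  set V := Submodule.span ℂ (Set.range fun i => fderiv ℂ (evalOrZero ↑U (t i) ∘ e.symm) (e Q₀))
    with hV
  -- every coordinate form lies in `V`
  have hproj : ∀ i, (ContinuousLinearMap.proj i : (Fin n → ℂ) →L[ℂ] ℂ) ∈ V := by
    intro i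
    obtain ⟨U₁, x, hsrc, hx⟩ := alg
    have hU₁ : Q₀.pt ∈ (↑U₁ : X.left.Opens) := hsrc hQ₀
    -- a basic open `D(u) ⊆ U ∩ U₁` around `Q₀`
    obtain ⟨u, hule, hQ₀u⟩ := U.2.exists_basicOpen_le ⟨Q₀.pt, hU₁⟩ hU
    obtain ⟨a, m, ham⟩ := AlgPoints.exists_map_mul_pow_eq_algebraMap U.2 u (x i) hule
    have hu0 : Q₀.eval ↑U hU u ≠ 0 := (AlgPoints.pt_mem_basicOpen_iff Q₀ hU u).1 hQ₀u
    -- pointwise on `D(u)(ℂ)`: `xᵢ(Q) u(Q)ᵐ = a(Q)`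
    have hpt : ∀ Q : ComplexPoints X, Q.pt ∈ X.left.basicOpen u →
        evalOrZero ↑U₁ (x i) Q * evalOrZero ↑U (u ^ m) Q = evalOrZero ↑U a Q := by
      intro Q hQ
      have hQU : Q.pt ∈ (↑U : X.left.Opens) := X.left.basicOpen_le u hQ
      have key := congrArg (Q.evalRingHom (X.left.basicOpen u) hQ) ham
      simp only [map_mul, map_pow, AlgPoints.evalRingHom_apply] at key
      rw [AlgPoints.eval_res Q hule hQ (x i)] at key
      have h1 : Q.eval (X.left.basicOpen u) hQ (algebraMap Γ(X.left, ↑U) _ u) = Q.eval ↑U hQU u :=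
        AlgPoints.eval_res Q (X.left.basicOpen_le u) hQ u
      have h2 : Q.eval (X.left.basicOpen u) hQ (algebraMap Γ(X.left, ↑U) _ a) = Q.eval ↑U hQU a :=
        AlgPoints.eval_res Q (X.left.basicOpen_le u) hQ a
      rw [h1, h2] at key
      rw [evalOrZero_of_mem _ (hule hQ), evalOrZero_of_mem _ hQU, evalOrZero_of_mem _ hQU,
        ← AlgPoints.evalRingHom_apply Q ↑U hQU, map_pow, AlgPoints.evalRingHom_apply]
      exact key
    have hev : evalOrZero ↑U a ∘ e.symm =ᶠ[𝓝 (e Q₀)]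
        fun w => (evalOrZero ↑U₁ (x i) ∘ e.symm) w • (evalOrZero ↑U (u ^ m) ∘ e.symm) w := by
      filter_upwards [eventually_chart_mem e hQ₀ hQ₀u] with w hw
      exact (hpt _ hw.2).symm
    have hdiffx : DifferentiableAt ℂ (evalOrZero ↑U₁ (x i) ∘ e.symm) (e Q₀) :=
      differentiableAt_chart e hQ₀ hol U₁ hU₁ (x i)
    have hdiffu : DifferentiableAt ℂ (evalOrZero ↑U (u ^ m) ∘ e.symm) (e Q₀) :=
      differentiableAt_chart e hQ₀ hol U hU (u ^ m)
    have hda := hev.fderiv_eq (𝕜 := ℂ)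
    rw [fderiv_fun_smul hdiffx hdiffu, fderiv_chart_coord e hQ₀ U₁ x hx i] at hda
    have ex : (evalOrZero ↑U₁ (x i) ∘ e.symm) (e Q₀) = Q₀.eval ↑U₁ hU₁ (x i) := by
      simp [e.left_inv hQ₀, evalOrZero_of_mem _ hU₁]
    have eu : (evalOrZero ↑U (u ^ m) ∘ e.symm) (e Q₀) = Q₀.eval ↑U hU (u ^ m) := by
      simp [e.left_inv hQ₀, evalOrZero_of_mem _ hU]
    have hsr : (ContinuousLinearMap.proj i : (Fin n → ℂ) →L[ℂ] ℂ).smulRight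
        (Q₀.eval ↑U hU (u ^ m)) =
        Q₀.eval ↑U hU (u ^ m) • (ContinuousLinearMap.proj i : (Fin n → ℂ) →L[ℂ] ℂ) := by
      ext v
      simp [mul_comm]
    rw [ex, eu, hsr] at hda
    -- solve for `proj i`
    have hum : Q₀.eval ↑U hU (u ^ m) ≠ 0 := by
      rw [← AlgPoints.evalRingHom_apply, map_pow, AlgPoints.evalRingHom_apply]
      exact pow_ne_zero _ hu0
    have e2 : (ContinuousLinearMap.proj i : (Fin n → ℂ) →L[ℂ] ℂ) =
        (Q₀.eval ↑U hU (u ^ m))⁻¹ • (fderiv ℂ (evalOrZero ↑U a ∘ e.symm) (e Q₀) -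
          Q₀.eval ↑U₁ hU₁ (x i) • fderiv ℂ (evalOrZero ↑U (u ^ m) ∘ e.symm) (e Q₀)) := by
      rw [hda, add_sub_cancel_left, smul_smul, inv_mul_cancel₀ hum, one_smul]
    rw [e2]
    exact Submodule.smul_mem _ _ (Submodule.sub_mem _
      (fderiv_chart_mem_span e hQ₀ hol U hU t htspan a)
      (Submodule.smul_mem _ _ (fderiv_chart_mem_span e hQ₀ hol U hU t htspan _)))
  -- hence `V = ⊤`
  have htop : ⊤ ≤ V := by
    intro ℓ _
    have hℓ : ℓ = ∑ i, ℓ (Pi.single i 1) • (ContinuousLinearMap.proj i : (Fin n → ℂ) →L[ℂ] ℂ) := by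
      ext w
      have hw := dual_apply_eq_sum ℓ.toLinearMap w
      simp only [ContinuousLinearMap.coe_coe] at hw
      rw [hw]
      simp [mul_comm]
    rw [hℓ]
    exact Submodule.sum_mem _ fun i _ => Submodule.smul_mem _ _ (hproj i)
  -- `n` vectors spanning an `n`-dimensional space are independent
  refine linearIndependent_of_top_le_span_of_card_eq_finrank htop ?_
  rw [Fintype.card_fin, ← LinearEquiv.finrank_eq (LinearMap.toContinuousLinearMap :
      ((Fin n → ℂ) →ₗ[ℂ] ℂ) ≃ₗ[ℂ] (Fin n → ℂ) →L[ℂ] ℂ),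
    Module.finrank_linearMap_self, Module.finrank_fin_fun]

include hQ₀ hol in
/-- **Lemma F.** Under the hypotheses of `linearIndependent_fderiv_chart`, an element of `𝔪`
with zero differential at `e Q₀` lies in `𝔪²` (the kernel of `d` on `𝔪` is exactly `𝔪²`).
[cite: SerreGAGA1956, §2 n°6 Cor. 2 with §1 n°4] -/
theorem mem_sq_of_fderiv_chart_eq_zero (U : X.left.affineOpens)
    (hU : Q₀.pt ∈ (↑U : X.left.Opens)) (t : Fin n → Γ(X.left, ↑U))
    (htspan : ∀ a ∈ RingHom.ker (Q₀.evalRingHom ↑U hU), ∃ coef : Fin n → ℂ,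
      a - ∑ i, SchemeOver.scalarRingHom X ↑U (coef i) * t i ∈
        RingHom.ker (Q₀.evalRingHom ↑U hU) ^ 2)
    (alg : ∃ (U₁ : X.left.affineOpens) (x : Fin n → Γ(X.left, ↑U₁)),
      e.source ⊆ {Q | Q.pt ∈ (↑U₁ : X.left.Opens)} ∧
        ∀ Q ∈ e.source, ∀ i, e Q i = evalOrZero ↑U₁ (x i) Q)
    {a : Γ(X.left, ↑U)} (ha : a ∈ RingHom.ker (Q₀.evalRingHom ↑U hU))
    (hda : fderiv ℂ (evalOrZero ↑U a ∘ e.symm) (e Q₀) = 0) :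
    a ∈ RingHom.ker (Q₀.evalRingHom ↑U hU) ^ 2 := by
  obtain ⟨coef, hcoef⟩ := htspan a ha
  have hli := linearIndependent_fderiv_chart e hQ₀ hol U hU t htspan alg
  have h0 := fderiv_chart_eq_zero_of_mem_sq e hQ₀ hol U hU hcoef
  have e1 : a - ∑ i, SchemeOver.scalarRingHom X ↑U (coef i) * t i +
      ∑ i, SchemeOver.scalarRingHom X ↑U (coef i) * t i = a := by ring
  have hsum : ∑ i, coef i • fderiv ℂ (evalOrZero ↑U (t i) ∘ e.symm) (e Q₀) = 0 := by
    have h1 := congrArg (fun b => fderiv ℂ (evalOrZero ↑U b ∘ e.symm) (e Q₀)) e1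
    rw [fderiv_chart_add e hQ₀ hol U hU, h0, zero_add, hda, fderiv_chart_sum e hQ₀ hol U hU] at h1
    simp only [fderiv_chart_smul e hQ₀ hol U hU] at h1
    exact h1
  have hc : ∀ i, coef i = 0 := Fintype.linearIndependent_iff.1 hli coef hsum
  simp only [hc, map_zero, zero_mul, Finset.sum_const_zero, sub_zero] at hcoef
  exact hcoef

end Chart

end GAGADimension

end Literature.AlgebraicGeometry.HodgeTheory
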